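import Summits.BirchSwinnertonDyer.Rank1Residual.X2.GreenbergVatsalStrictSelmerMultiplicative
import Summits.BirchSwinnertonDyer.Rank1Residual.X2.NonPrimitiveSelmerGVEquality
import HarnessLib

/-!
# GV's non-primitive Selmer group at `p ‖ N`: `Sel^{Σ₀}_E(ℚ_∞)_p = S^{Σ₀,str}_{E[p^∞]}(ℚ_∞)` for the
# Tate datum (`= S^{Σ₀}` at a non-split `p`), with NO local named fact — the `p ‖ N` twin of gen 11's
# `Sel^{Σ₀}_E(ℚ_∞)_p = S^{Σ₀}_A(ℚ_∞)` (GV p. 26, good ordinary, modulo A111)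

HONEST FRAMING (cell `b2b-bsdres`, run/shared/lean/b2b/bsd-rank1-residual/, verbatim in every
file): the goal of the cell is to DELETE the COMBINATION-SHAPED residual classes of the
Birch–Swinnerton-Dyer formula for ALL analytic-rank `≤ 1` elliptic curves over `ℚ` — "full BSD
formula for every rank `≤ 1` curve in class `C`" assembled STRICTLY from published theorems — so
that the rank-`≤ 1` remainder becomes exactly the CONSTRUCTION-SHAPED classes, which are TYPED
(missing-input `Prop`s), NOT attempted. This is not "finishing BSD". Sub-cell
`b2b-bsdres-eisenstein-p2` (CLASS-OWNERS row "X2"), gen 12: research route; NO CLAIM BEYOND STATED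
CLASSES; nothing here changes a label. THEOREMS ONLY; §2 CONDITIONAL only on the tree's named facts
`Silverman1994_thmV53_tateUniformisation` / `Silverman1994_thmV53_corV54_tateUniformisation`
(Silverman *ATAEC* V.3.1/V.5.2–5.4, PUBLISHED; hypotheses `hT`).

WHY. The Literature object on which GV's printed relations (5)–(7) are typed is the non-primitive
CLASSICAL Selmer group `Sel^{Σ₀}_E(ℚ_∞)_p` (`GreenbergVatsal2000.nonPrimitiveSelmerInfty`, gen 11;
facts A115/A116 at good ordinary `p`). Route G's kernel transfer (gens 8–9) is about Greenberg–Vatsal's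
`S^{Σ₀}_A(ℚ_∞)` (`gvSelmerInfty`). Gen 11 linked them at a good ordinary `p` modulo the local fact
A111. THIS FILE links them at `p ‖ N` with NO local fact (gen 12: Greenberg p. 76 proved):
* §1 (any number field, any data) `nonPrimitiveSelmerGroupOver_le_gvStrictSelmer` (given
  `localKerOver ≤ strictKer` above `p`); over `K_∞^{cyc}`:
  **`nonPrimitiveSelmerInfty_eq_gvStrictSelmerInfty_of_le`** — `Sel^{Σ₀}_E(K_∞)_p = S^{Σ₀,str}(K_∞)`
  given the two local inclusions at `p` (`p` odd, `Σ₀ ∌ p`, `Σ₀ ⊇ bad ∖ p`);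
* §2 over `ℚ` at an odd `p ‖ N`: **`exists_data_nonPrimitiveSelmerInfty_eq_of_not_split`** —
  `Sel^{Σ₀}_E(ℚ_∞)_p = S^{Σ₀,str} = S^{Σ₀}_{E[p^∞]}(ℚ_∞)` (Tate data, A41 only);
  **`exists_data_nonPrimitiveSelmerInfty_eq_of_split`** — `Sel^{Σ₀}_E(ℚ_∞)_p = S^{Σ₀,str} ≤ S^{Σ₀}`
  with the trivial-zero embedding at `p` (A40 only). So at a NON-split `p ‖ N` GV's
  `Sel^{Σ₀}_E(ℚ_∞)_p` IS the object `S^{Σ₀}` of the gen-9 transfer.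

References: Greenberg–Vatsal 2000 §1 pp. 7–8, §2 pp. 14–17, 26; Greenberg, LNM 1716 (1999) §2
pp. 69–76.
-/

noncomputable section

open scoped Classical

universe u

namespace Summit.BirchSwinnertonDyer.Rank1Residual.X2.NonPrimitiveSelmerStrictEquality

open NumberField IsDedekindDomain Field Literature.NumberTheory.GaloisRepresentations
  Literature.NumberTheory.EllipticCurves Literature.NumberTheory.EllipticCurves.GreenbergSelmer
  Literature.NumberTheory.EllipticCurves.GreenbergVatsal2000 IsDedekindDomain.HeightOneSpectrum
  Summit.BirchSwinnertonDyer.Rank1Residual.X2.GreenbergVatsalTorsion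
  Summit.BirchSwinnertonDyer.Rank1Residual.X2.GreenbergVatsalTateDatum
  Summit.BirchSwinnertonDyer.Rank1Residual.X2.GreenbergVatsalTateDatumSign
  Summit.BirchSwinnertonDyer.Rank1Residual.X2.GreenbergVatsalStrictSelmer
  Summit.BirchSwinnertonDyer.Rank1Residual.X2.GreenbergVatsalTateKummer
  Summit.BirchSwinnertonDyer.Rank1Residual.X2.GreenbergVatsalStrictSelmerMultiplicative

/-! ## §1. `Sel^{Σ₀}_E(L)_p` versus `S^{Σ₀,str}_{E[p^∞]}(L)` -/

section Link

variable {K : Type u} [Field K] [NumberField K] (W : WeierstrassCurve K) [W.IsElliptic] (p : ℕ)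
  (H : Subgroup (absoluteGaloisGroup K)) [H.Normal]
  (L : Data K (W.geomPrimaryTorsion p) p) (S₀ : Set (HeightOneSpectrum (𝓞 K)))

/-- **`Sel^{Σ₀}_E(L)_p ⊆ S^{Σ₀,str}_{E[p^∞]}(L)`** for `Σ₀ ∌ p`, `Σ₀ ⊇ bad ∖ p`, and data with the
Kummer ⇒ STRICT implication above `p` (`hle`; kernel at `p ‖ N`: gen 12).
[cite: GreenbergVatsal2000, §2 pp. 15, 19] [cite: GreenbergLNM1716, §2 pp. 69–76] -/
theorem nonPrimitiveSelmerGroupOver_le_gvStrictSelmer (hS₀ : ∀ v ∈ S₀, ((p : ℕ) : 𝓞 K) ∉ v.asIdeal)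
    (hS : ∀ v : HeightOneSpectrum (𝓞 K), v ∉ S₀ → ((p : ℕ) : 𝓞 K) ∉ v.asIdeal →
      W.HasGoodReductionAt v)
    (hle : ∀ (v : HeightOneSpectrum (𝓞 K)) (hv : ((p : ℕ) : 𝓞 K) ∈ v.asIdeal),
      W.localKerOver p H (v.adicCompletion K) ≤ (L v hv).strictKer H) :
    nonPrimitiveSelmerGroupOver W p H S₀ ≤ gvStrictSelmer H (W.geomPrimaryTorsion p) p L S₀ := by
  intro c hc
  rw [mem_nonPrimitiveSelmerGroupOver_iff] at hc
  rw [mem_gvStrictSelmer_iff]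
  refine ⟨fun v hv hpv σ ↦ GreenbergVatsalSelmerLink.localKerOver_le_unramKer W p H (hS v hv hpv)
      hpv (hc.1 v hv σ),
    fun v hv σ ↦ hle v hv (hc.1 v ?_ σ)⟩
  exact fun hvS ↦ hS₀ v hvS hv

end Link

section Cyclotomic

-- universe `0`: the tree's cyclotomic lemmas live in `Type`
variable {K : Type} [Field K] [NumberField K] (W : WeierstrassCurve K) [W.IsElliptic] (p : ℕ)
  [Fact p.Prime] (κ : ZpExtension K p) (L : Data K (W.geomPrimaryTorsion p) p)
  (S₀ : Set (HeightOneSpectrum (𝓞 K)))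

/-- **`Sel^{Σ₀}_E(K_∞)_p = S^{Σ₀,str}_{E[p^∞]}(K_∞)`** for any number field `K`, `p` ODD, `κ`
CYCLOTOMIC, `Σ₀ ∌ p` with every `v ∉ Σ₀ ∪ {p}` good, and data `L` with the two local inclusions at
`p` (`hle : localKerOver ≤ strictKer`, `hge : strictKer ≤ localKerOver` — both KERNEL theorems for
the Tate data at `p ‖ N`, gen 12). `⊆`: §1; `⊇`: GV p. 17 away from `p` (kernel), vacuous at `∞`
(odd `p`), `hge` at `p`. [cite: GreenbergVatsal2000, §2 pp. 15, 17, 26]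
[cite: GreenbergLNM1716, §2 pp. 69–76] -/
theorem nonPrimitiveSelmerInfty_eq_gvStrictSelmerInfty_of_le (hp2 : p ≠ 2) (hκ : κ.IsCyclotomic)
    (hS₀ : ∀ v ∈ S₀, ((p : ℕ) : 𝓞 K) ∉ v.asIdeal)
    (hS : ∀ v : HeightOneSpectrum (𝓞 K), v ∉ S₀ → ((p : ℕ) : 𝓞 K) ∉ v.asIdeal →
      W.HasGoodReductionAt v)
    (hle : ∀ (v : HeightOneSpectrum (𝓞 K)) (hv : ((p : ℕ) : 𝓞 K) ∈ v.asIdeal),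
      W.localKerOver p κ.kerSubgroup (v.adicCompletion K) ≤ (L v hv).strictKer κ.kerSubgroup)
    (hge : ∀ (v : HeightOneSpectrum (𝓞 K)) (hv : ((p : ℕ) : 𝓞 K) ∈ v.asIdeal),
      (L v hv).strictKer κ.kerSubgroup ≤ W.localKerOver p κ.kerSubgroup (v.adicCompletion K)) :
    nonPrimitiveSelmerInfty W κ S₀ = gvStrictSelmerInfty κ (W.geomPrimaryTorsion p) L S₀ := by
  apply le_antisymm
  · exact fun c hc ↦ nonPrimitiveSelmerGroupOver_le_gvStrictSelmer W p κ.kerSubgroup L S₀ hS₀ hS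
      hle hc
  intro c hgv
  change c ∈ nonPrimitiveSelmerGroupOver W p κ.kerSubgroup S₀
  rw [mem_nonPrimitiveSelmerGroupOver_iff]
  refine ⟨fun v hvS σ ↦ ?_, fun w σ ↦ ?_⟩
  · by_cases hpv : ((p : ℕ) : 𝓞 K) ∈ v.asIdeal
    · exact hge v hpv (((mem_gvStrictSelmer_iff c).1 hgv).2 v hpv σ)
    · have hgv' : c ∈ gvSelmerInfty κ (W.geomPrimaryTorsion p) L S₀ :=
        gvStrictSelmer_le_gvSelmer κ.kerSubgroup (W.geomPrimaryTorsion p) p L S₀ hgv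
      exact GreenbergVatsalUnramifiedAway.conjH1_mem_localKerOver_of_mem_gvSelmerInfty_of_isCyclotomic
        (κ := κ) (v := v) (W := W) (p := p) hκ L S₀ hgv' hvS (hS v hvS hpv) hpv σ
  · rw [GreenbergVatsalSelmerEquality.localKerOver_completion_eq_top_of_odd W p hp2]
    exact AddSubgroup.mem_top _

end Cyclotomic

/-! ## §2. Over `ℚ` at an odd `p ‖ N`: NO local named fact -/

section Rat

variable (W : WeierstrassCurve ℚ) [W.IsGloballyMinimal] [W.IsElliptic] (p : ℕ) [hp : Fact p.Prime]
  (κ : ZpExtension ℚ p) (S₀ : Set (HeightOneSpectrum (𝓞 ℚ)))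

/-- **At an odd NON-SPLIT `p ‖ N`: `Sel^{Σ₀}_E(ℚ_∞)_p = S^{Σ₀,str} = S^{Σ₀}_{E[p^∞]}(ℚ_∞)` for Tate
data** (GV's `htriv` included), granted only the twisted Tate uniformisation `hT` — so the
`p`-torsion of `Sel^{Σ₀}_E(ℚ_∞)_p` is the object `S^{Σ₀} ⊓ H¹[p]` of the gen-9 transfer
`natCard_gvSelmerInfty_inf_torsion_eq_of_torsionIso`, exactly as gen 11 at a good ordinary prime
(there modulo A111; here with no local fact). [cite: GreenbergVatsal2000, §1 pp. 7–8, §2 pp. 14–16, 26]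
[cite: SilvermanATAEC1994, Ch. V Lemma 5.2 (c), Thm. 5.3 (a),(b), Cor. 5.4 (held copy PDF pp. 406–410)] -/
theorem exists_data_nonPrimitiveSelmerInfty_eq_of_not_split
    (hT : Silverman1994_thmV53_corV54_tateUniformisation.{0}) (hκ : κ.IsCyclotomic) (hp2 : p ≠ 2)
    (hmult : W.HasMultiplicativeReductionAtPrime p) (hns : ¬ W.HasSplitMultiplicativeReductionAtPrime p)
    (hS₀ : ∀ v ∈ S₀, ((p : ℕ) : 𝓞 ℚ) ∉ v.asIdeal)
    (hS : ∀ v : HeightOneSpectrum (𝓞 ℚ), v ∉ S₀ → ((p : ℕ) : 𝓞 ℚ) ∉ v.asIdeal →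
      W.HasGoodReductionAt v) :
    ∃ L : Data ℚ (W.geomPrimaryTorsion p) p,
      (∀ (v : HeightOneSpectrum (𝓞 ℚ)) (hv : ((p : ℕ) : 𝓞 ℚ) ∈ v.asIdeal),
        ∀ x ∈ inertia v, ∀ m : W.geomPrimaryTorsion p, x • m - m ∈ (L v hv).plus) ∧
      nonPrimitiveSelmerInfty W κ S₀ = gvStrictSelmerInfty κ (W.geomPrimaryTorsion p) L S₀ ∧
      nonPrimitiveSelmerInfty W κ S₀ = gvSelmerInfty κ (W.geomPrimaryTorsion p) L S₀ := by
  -- the same local package as in `GreenbergVatsalStrictSelmerMultiplicative`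
  have key : ∀ (v : HeightOneSpectrum (𝓞 ℚ)) (hv : ((p : ℕ) : 𝓞 ℚ) ∈ v.asIdeal),
      ∃ N : LocalDatum ℚ (W.geomPrimaryTorsion p) v,
        (∀ x ∈ inertia v, ∀ m : W.geomPrimaryTorsion p, x • m - m ∈ N.plus) ∧
        N.greenbergKer κ.kerSubgroup = N.strictKer κ.kerSubgroup ∧
        W.localKerOver p κ.kerSubgroup (v.adicCompletion ℚ) ≤ N.strictKer κ.kerSubgroup ∧
        N.strictKer κ.kerSubgroup ≤ W.localKerOver p κ.kerSubgroup (v.adicCompletion ℚ) := by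
    intro v hv
    obtain ⟨q, t, Ψ, hq0, hq1, -, ht2, hsurj, hker, hΨσ, -⟩ :=
      hT W v (hasMultiplicativeReductionAt_of_mem W p hmult hv)
    have hΨI : ∀ σ ∈ absInertia (v.adicCompletion ℚ),
        ∀ u : (AlgebraicClosure (v.adicCompletion ℚ))ˣ,
        σ • Ψ (Additive.ofMul u) = Ψ (Additive.ofMul (Units.map
          (Field.absoluteGaloisGroup.toAlgEquiv (v.adicCompletion ℚ) σ :
            AlgebraicClosure (v.adicCompletion ℚ) →* AlgebraicClosure (v.adicCompletion ℚ)) u)) := by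
      intro σ hσ u
      rw [hΨσ σ u, if_pos (GreenbergVatsalTateDatumRat.inertia_fix_sqrt_gamma W hp2 hmult hv t ht2 σ hσ),
        one_zsmul]
    have ht0 : t ≠ 0 := by
      intro h0
      rw [h0] at ht2
      have h4 : W.c₄ = ((WeierstrassCurve.integralModelInt W).c₄ : ℚ) := by
        conv_lhs => rw [← WeierstrassCurve.map_integralModelInt W]
        rw [WeierstrassCurve.map_c₄, eq_intCast]
      have h6 : W.c₆ = ((WeierstrassCurve.integralModelInt W).c₆ : ℚ) := by
        conv_lhs => rw [← WeierstrassCurve.map_integralModelInt W]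
        rw [WeierstrassCurve.map_c₆, eq_intCast]
      obtain ⟨-, hc₄⟩ := Additive.dvd_and_not_dvd_c₄_of_hasMultiplicativeReductionAtPrime W p hmult
      have hc₆ := GreenbergVatsalTateDatumRat.not_dvd_c₆_of_hasMultiplicativeReductionAtPrime W hmult
      have hγ0 : (-(W.c₄ / W.c₆) : ℚ) = 0 := by
        have h := ht2.symm
        rw [zero_pow two_ne_zero, ← IsScalarTower.algebraMap_apply, map_eq_zero_iff _
          (algebraMap ℚ (AlgebraicClosure (v.adicCompletion ℚ))).injective] at h
        exact h
      rw [h4, h6, neg_eq_zero, div_eq_zero_iff, Int.cast_eq_zero, Int.cast_eq_zero] at hγ0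
      rcases hγ0 with h | h
      · exact hc₄ (by rw [h]; exact dvd_zero _)
      · exact hc₆ (by rw [h]; exact dvd_zero _)
    set N := tateDatum W p Ψ (sign_disj W Ψ t hΨσ) with hN
    have heq : N.greenbergKer κ.kerSubgroup = N.strictKer κ.kerSubgroup :=
      GreenbergVatsalStrictAtNonsplit.greenbergKer_eq_strictKer_tate_of_flip W p κ Ψ t hΨσ hsurj
        (fun u h ↦ (hker u).1 h) ht0 ht2 hκ hp2 hmult hns hv
    refine ⟨N, tateDatum_htriv W p Ψ _ hsurj (fun u h ↦ (hker u).1 h) hΨI, heq, ?_, ?_⟩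
    · exact (GreenbergVatsalSelmerLink.localKerOver_le_greenbergKer W p κ.kerSubgroup N
        (tateDatum_kummer W p Ψ _ hsurj (fun u h ↦ (hker u).1 h) hΨI hq0 hq1)).trans heq.le
    · exact strictKer_le_localKerOver_tate W p Ψ t hq0 hq1 (fun u h ↦ (hker u).1 h) hΨσ N
        (mem_tateDatum_plus_iff _) κ.kerSubgroup hp2 (smul_sqrt_eq_or W t ht2)
  choose N hN₁ hN₂ hN₃ hN₄ using key
  have hstrict := gvStrictSelmerInfty_eq_gvSelmerInfty_of_forall_eq κ (W.geomPrimaryTorsion p) N S₀ hN₂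
  have heq := nonPrimitiveSelmerInfty_eq_gvStrictSelmerInfty_of_le W p κ N S₀ hp2 hκ hS₀ hS hN₃ hN₄
  have heq' : nonPrimitiveSelmerInfty W κ S₀ = gvSelmerInfty κ (W.geomPrimaryTorsion p) N S₀ :=
    heq.trans hstrict
  exact ⟨N, hN₁, heq, heq'⟩

omit [W.IsGloballyMinimal] in
/-- **At a SPLIT `p ‖ N` (`p` odd): `Sel^{Σ₀}_E(ℚ_∞)_p = S^{Σ₀,str}_{E[p^∞]}(ℚ_∞) ≤ S^{Σ₀}`** for the
Tate data of the untwisted parametrisation (`D_v` trivial on `D`, GV's `htriv`), granted only `hT`;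
with the trivial-zero embedding `e : greenbergKer → D`, `e c = 0 ↔ c ∈ strictKer` at each `v ∣ p`.
[cite: GreenbergVatsal2000, §1 pp. 7–8, §2 pp. 14–16]
[cite: SilvermanATAEC1994, Ch. V Thm. 3.1 (c),(d) p. 423 and §V.5 Thm. 5.3 (a),(b)] -/
theorem exists_data_nonPrimitiveSelmerInfty_eq_of_split
    (hT : Silverman1994_thmV53_tateUniformisation.{0}) (hκ : κ.IsCyclotomic) (hp2 : p ≠ 2)
    (hsplit : W.HasSplitMultiplicativeReductionAtPrime p)
    (hS₀ : ∀ v ∈ S₀, ((p : ℕ) : 𝓞 ℚ) ∉ v.asIdeal)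
    (hS : ∀ v : HeightOneSpectrum (𝓞 ℚ), v ∉ S₀ → ((p : ℕ) : 𝓞 ℚ) ∉ v.asIdeal →
      W.HasGoodReductionAt v) :
    ∃ L : Data ℚ (W.geomPrimaryTorsion p) p,
      (∀ (v : HeightOneSpectrum (𝓞 ℚ)) (hv : ((p : ℕ) : 𝓞 ℚ) ∈ v.asIdeal),
        ∀ x ∈ inertia v, ∀ m : W.geomPrimaryTorsion p, x • m - m ∈ (L v hv).plus) ∧
      (∀ (v : HeightOneSpectrum (𝓞 ℚ)) (hv : ((p : ℕ) : 𝓞 ℚ) ∈ v.asIdeal),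
        ∀ (δ : decomp (K := ℚ) v) (d : (L v hv).Gr), δ • d = d) ∧
      nonPrimitiveSelmerInfty W κ S₀ = gvStrictSelmerInfty κ (W.geomPrimaryTorsion p) L S₀ ∧
      nonPrimitiveSelmerInfty W κ S₀ ≤ gvSelmerInfty κ (W.geomPrimaryTorsion p) L S₀ ∧
      ∀ (v : HeightOneSpectrum (𝓞 ℚ)) (hv : ((p : ℕ) : 𝓞 ℚ) ∈ v.asIdeal),
        ∃ e : (L v hv).greenbergKer κ.kerSubgroup →+ (L v hv).Gr,
          ∀ c : (L v hv).greenbergKer κ.kerSubgroup,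
            e c = 0 ↔ (c : W.subgroupH1 p κ.kerSubgroup) ∈ (L v hv).strictKer κ.kerSubgroup := by
  have key : ∀ (v : HeightOneSpectrum (𝓞 ℚ)) (hv : ((p : ℕ) : 𝓞 ℚ) ∈ v.asIdeal),
      ∃ N : LocalDatum ℚ (W.geomPrimaryTorsion p) v,
        (∀ x ∈ inertia v, ∀ m : W.geomPrimaryTorsion p, x • m - m ∈ N.plus) ∧
        (∀ (δ : decomp (K := ℚ) v) (d : N.Gr), δ • d = d) ∧
        W.localKerOver p κ.kerSubgroup (v.adicCompletion ℚ) ≤ N.strictKer κ.kerSubgroup ∧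
        N.strictKer κ.kerSubgroup ≤ W.localKerOver p κ.kerSubgroup (v.adicCompletion ℚ) ∧
        ∃ e : N.greenbergKer κ.kerSubgroup →+ N.Gr, ∀ c : N.greenbergKer κ.kerSubgroup,
          e c = 0 ↔ (c : W.subgroupH1 p κ.kerSubgroup) ∈ N.strictKer κ.kerSubgroup := by
    intro v hv
    obtain ⟨q, Φ, hq0, hq1, hsurj, hker, hΦσ, -⟩ :=
      hT W v (hasSplitMultiplicativeReductionAt_of_mem W p hsplit hv)
    set N := tateDatum W p Φ (sign_disj W Φ 0 (sign_of_equivariant W Φ hΦσ)) with hN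
    have htrivD : ∀ (δ : decomp (K := ℚ) v) (d : N.Gr), δ • d = d :=
      smul_gr_eq_of_equivariant W p Φ hΦσ hsurj (fun u h ↦ (hker u).1 h)
    refine ⟨N, tateDatum_htriv W p Φ _ hsurj (fun u h ↦ (hker u).1 h) (fun σ _ u ↦ hΦσ σ u),
      htrivD, ?_, ?_, ?_⟩
    · exact localKerOver_le_strictKer_of_kummer_all W p κ.kerSubgroup N
        (tateDatum_kummer_all W p Φ hΦσ hsurj (fun u h ↦ (hker u).1 h) hq0 hq1)
    · exact strictKer_le_localKerOver_tate W p Φ 0 hq0 hq1 (fun u h ↦ (hker u).1 h)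
        (sign_of_equivariant W Φ hΦσ) N (mem_tateDatum_plus_iff _) κ.kerSubgroup hp2
        (fun σ ↦ Or.inl (smul_zero σ))
    · exact GreenbergVatsalStrictAtSplit.exists_addMonoidHom_apply_eq_zero_iff_of_trivial W p κ N
        htrivD hκ hv
  choose N hN₁ hN₂ hN₃ hN₄ hN₅ using key
  have heq := nonPrimitiveSelmerInfty_eq_gvStrictSelmerInfty_of_le W p κ N S₀ hp2 hκ hS₀ hS hN₃ hN₄
  exact ⟨N, hN₁, hN₂, heq, heq.le.trans (gvStrictSelmerInfty_le_gvSelmerInfty κ _ N S₀), hN₅⟩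

end Rat

end Summit.BirchSwinnertonDyer.Rank1Residual.X2.NonPrimitiveSelmerStrictEquality

end
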